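import Mathlib
import HarnessLib
import Summits.HubbardSuperconductivity.HubbardSuperconductivity.Theorems.KLProgrammeKLRegimeEngineV8DefsU12b
import Summits.HubbardSuperconductivity.HubbardSuperconductivity.Theorems.KLProgrammeKLRegimeEngineV8GridLiteralsPkgG

/-!
# K3 ENGINE package, U-level v12b AT A GEOMETRY SLOT `G`: `klEngU₀12G G P R cc := klEngU₀12 P R cc ⊓ ⟨every G-keyed U12b entry re-keyed at G⟩` — registrant PRESTAGE
# for the post-FREEZE G-token motion «AMENDMENT 24 — (c)-OUT» (plan g23 (R237)/(R243): `klEngGeo11 ↦ klEngGeo13`; candidate successor `klEngGeo14`, AMENDMENT 24+25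
# (R257)); cell gate-hubbard-kl, seat gate-hubbard-kl-p1b g16 (20437 v2 registrant lineage; DefsU12b = D3″ of the v8.30 FREEZE text, p661651, filed by this lineage)

WHY.  Token #14 `klEngU₀12 P R cc` (D3″) is the core `klEngU₀12Core` capped by the U12b entries AT THE rev-13/14 TOKENS `(klEngGeo11, klEngQ9c P R, klEngGeoTh)`.  Twelve of
its entries are keyed at the G token: `klIsoMomU klEngGeo11 …`, `klE4UF klEngGeo11 …`, `klE5FrU klEngGeo11 R`, `klCTu7 … klEngGeo11 klEngGeoTh …`, `klE5RowsU11 =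
klE5RowsUG klEngGeo11 …`, `klZspU5 … klEngGeo11 …`, `klGridLitUAt` and the four #28 literal rows (`klTwoLegMomU R (klZt P R) (klZs2 P R)`, `1/(64(|klZs2|+1))`,
`R.cz/(1200(klZs1+1))`, `1/(20(klZs1+1))` — the literals are `klEngGeo11`-keyed), `klTowerCoreUC9 … (klEngQ9c P R) cc` (D4's capped core, deferred at `klEngGeo11`).
Under a G-token motion of the image (AMENDMENT 24: every `klEngGeo11` site ↦ the successor; all seven rows move) the composition §C and the stub closers read the SAME
rows at the successor token — e.g. §C's `hUle.trans (klEngU₀12_le_klZspU5 P R c)` must produce `U ≤ klZspU5 P R (klEngQ7 P R) G' (klEngQ9c P R) c`, the (b) closer's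
`klEngU₀12_le_klTowerCoreUC9 / _le_klIsoMomU / _le_klGridLitUAt` their G'-keyed thresholds.  This file is that threshold with `G` an explicit PARAMETER (one text for
`klEngGeo13` / `klEngGeo14` / any later successor): **`klEngU₀12G G P R cc`** = `klEngU₀12 P R cc` (ALL frozen entries kept — nothing a holder of the frozen doors loses)
`⊓` the twelve G-keyed entries at `G` + `klTowerCoreUC9G G P R (klEngQ9c P R) cc`, with
* one `klEngU₀12G_le_<entry>` projection per G-keyed entry, NAMED as §C / the closers read them (`klEngU₀12G_le_klZspU5 : … ≤ klZspU5 P R (klEngQ7 P R) G (klEngQ9c P R) cc`,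
  `_le_klCTu7`, `_le_klIsoMomU`, `_le_klE4UF`, `_le_klE5FrU`, `_le_klE5RowsUG`, `_le_klGridLitUAtG`, `_le_klTwoLegMomU`, `_le_inv_klZs2G`, `_le_cz_klZs1G`, `_le_inv_klZs1G`,
  `_le_klTowerCoreUC9G`);
* `klEngU₀12G_le_klEngU₀12` and through it EVERY G-free row of D3″ by name (`_le_klEngU₀10` — THE #14 LIFT LINE —, `_le_klCUu2`, `_le_klE5uM`, `_le_klE5ShareU2`, `_le_klTowerU`,
  `_le_klEngU₀9`, `_le_klEngU₀3`, `_le_klTSU`, `_le_klLastRespU`, `_le_klGridU₀`, `_le_inv_klReadOscC`, `_le_klTailBookU`, `_le_klTowerUC`);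
* **`klEngU₀12G_pos P cc hG hP hR`** (`G.WF` needed by `klE5FrU_pos_of_wf`; the G-keyed image's witness line reads `klEngU₀12G_pos P c G'_wf hP hR`).
NOT A MOTION: no token of record moves here.  Definitions with bodies + order lemmas; nothing about the model is asserted; nothing asserts any stub of 20437, K3 or
superconductivity.
-/

noncomputable section

namespace Summit.HubbardSuperconductivity.HubbardSuperconductivity.Theorems.EngineV8

set_option linter.dupNamespace false -- summit = problem name (single-conjunct summit), D-0017

open Real Finset Literature.MathematicalPhysics.QuantumLattice Literature.Probability.LatticeModels
open Summit.HubbardSuperconductivity.HubbardSuperconductivity.Theorems.KLRegimeSplit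
open Summit.HubbardSuperconductivity.HubbardSuperconductivity.Theorems.KLProgrammeLegKernels
open Summit.HubbardSuperconductivity.HubbardSuperconductivity.Theorems.DispersionFlow

/-! ## §1 Token #14 at the geometry slot -/

/-- **`klEngU₀12G G P R cc`** — token #14 of the v2 FREEZE re-keyed at the geometry slot `G`: the frozen `klEngU₀12 P R cc` (all its entries, G-free and
`klEngGeo11`-keyed alike) capped by the G-keyed twins of the twelve U12b entries AT `G` — class #6 moment row `klIsoMomU G …`, class #4 `klE4UF G …`, (F)(i) insurance
`klE5FrU G R`, class #5 «REL-DIRECT» `klCTu7 … G klEngGeoTh …`, the (c)-E5 rows entry `klE5RowsUG G P (klEngQ9c P R)`, #17 `klZspU5 … G …`, the grid producer's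
`klGridLitUAtG G …`, the four #28 literal rows on `klZtG / klZs1G / klZs2G G P R`, and D4-at-G's capped core threshold `klTowerCoreUC9G G P R (klEngQ9c P R) cc` LAST. -/
def klEngU₀12G (G : GeoConsts) (P : SplitConsts) (R : RenConsts) (cc : ℝ) : ℝ :=
  min (klEngU₀12 P R cc)
    (min (klIsoMomU G P R (klEngQ9c P R) cc)
      (min (klE4UF G P R (klEngQ9c P R) cc)
        (min (klE5FrU G R)
          (min (klCTu7 P R (klEngQ7 P R) G klEngGeoTh (klEngQ9c P R) cc)
            (min (klE5RowsUG G P (klEngQ9c P R))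
              (min (klZspU5 P R (klEngQ7 P R) G (klEngQ9c P R) cc)
                (min (klGridLitUAtG G P R (klEngQ9c P R) cc)
                  (min (klTwoLegMomU R (klZtG G P R) (klZs2G G P R))
                    (min (1 / (64 * (|klZs2G G P R| + 1)))
                      (min (R.cz / (1200 * (klZs1G G P R + 1)))
                        (min (1 / (20 * (klZs1G G P R + 1))) (klTowerCoreUC9G G P R (klEngQ9c P R) cc))))))))))))

section Projections

variable (G : GeoConsts) (P : SplitConsts) (R : RenConsts) (cc : ℝ)

/-- `klEngU₀12G G P R cc ≤ klEngU₀12 P R cc` — every frozen U12b door is kept. -/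
theorem klEngU₀12G_le_klEngU₀12 : klEngU₀12G G P R cc ≤ klEngU₀12 P R cc := min_le_left _ _

/-- `klEngU₀12G ≤ klIsoMomU G P R (klEngQ9c P R) cc` (class #6 moment-package threshold at `G`; the (b) closer's `hUle.trans (klEngU₀12G_le_klIsoMomU G P R c)`). -/
theorem klEngU₀12G_le_klIsoMomU : klEngU₀12G G P R cc ≤ klIsoMomU G P R (klEngQ9c P R) cc := (min_le_right _ _).trans (min_le_left _ _)

/-- `klEngU₀12G ≤ klE4UF G P R (klEngQ9c P R) cc` (class #4 (E4) flow threshold at `G`). -/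
theorem klEngU₀12G_le_klE4UF : klEngU₀12G G P R cc ≤ klE4UF G P R (klEngQ9c P R) cc :=
  (min_le_right _ _).trans ((min_le_right _ _).trans (min_le_left _ _))

/-- `klEngU₀12G ≤ klE5FrU G R` ((F)(i) insurance at `G`). -/
theorem klEngU₀12G_le_klE5FrU : klEngU₀12G G P R cc ≤ klE5FrU G R :=
  (min_le_right _ _).trans ((min_le_right _ _).trans ((min_le_right _ _).trans (min_le_left _ _)))

/-- `klEngU₀12G ≤ klCTu7 P R (klEngQ7 P R) G klEngGeoTh (klEngQ9c P R) cc` (class #5 «REL-DIRECT» threshold at `G`; §C row `hUle.trans (klEngU₀12G_le_klCTu7 G P R c)`). -/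
theorem klEngU₀12G_le_klCTu7 : klEngU₀12G G P R cc ≤ klCTu7 P R (klEngQ7 P R) G klEngGeoTh (klEngQ9c P R) cc :=
  (min_le_right _ _).trans ((min_le_right _ _).trans ((min_le_right _ _).trans ((min_le_right _ _).trans (min_le_left _ _))))

/-- `klEngU₀12G ≤ klE5RowsUG G P (klEngQ9c P R)` ((c)-E5 accumulated-rows entry at `G`; `= klE5RowsU11 P R` at `klEngGeo11`). -/
theorem klEngU₀12G_le_klE5RowsUG : klEngU₀12G G P R cc ≤ klE5RowsUG G P (klEngQ9c P R) :=
  (min_le_right _ _).trans ((min_le_right _ _).trans ((min_le_right _ _).trans ((min_le_right _ _).trans ((min_le_right _ _).trans (min_le_left _ _)))))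

/-- `klEngU₀12G ≤ klZspU5 P R (klEngQ7 P R) G (klEngQ9c P R) cc` (#17 «(C2)-MOMENTS» producer threshold at `G`; §C row `hUle.trans (klEngU₀12G_le_klZspU5 G P R c)`). -/
theorem klEngU₀12G_le_klZspU5 : klEngU₀12G G P R cc ≤ klZspU5 P R (klEngQ7 P R) G (klEngQ9c P R) cc :=
  (min_le_right _ _).trans ((min_le_right _ _).trans ((min_le_right _ _).trans ((min_le_right _ _).trans ((min_le_right _ _).trans ((min_le_right _ _).trans
    (min_le_left _ _))))))

/-- `klEngU₀12G ≤ klGridLitUAtG G P R (klEngQ9c P R) cc` (the grid-literal producer's threshold at `G`; the (b) closer's `hUu`). -/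
theorem klEngU₀12G_le_klGridLitUAtG : klEngU₀12G G P R cc ≤ klGridLitUAtG G P R (klEngQ9c P R) cc :=
  (min_le_right _ _).trans ((min_le_right _ _).trans ((min_le_right _ _).trans ((min_le_right _ _).trans ((min_le_right _ _).trans ((min_le_right _ _).trans
    ((min_le_right _ _).trans (min_le_left _ _)))))))

/-- `klEngU₀12G ≤ klTwoLegMomU R (klZtG G P R) (klZs2G G P R)` (the (e) closer's `hUm` at the G-keyed literals). -/
theorem klEngU₀12G_le_klTwoLegMomU : klEngU₀12G G P R cc ≤ klTwoLegMomU R (klZtG G P R) (klZs2G G P R) :=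
  (min_le_right _ _).trans ((min_le_right _ _).trans ((min_le_right _ _).trans ((min_le_right _ _).trans ((min_le_right _ _).trans ((min_le_right _ _).trans
    ((min_le_right _ _).trans ((min_le_right _ _).trans (min_le_left _ _))))))))

/-- `klEngU₀12G ≤ 1/(64·(|klZs2G G P R|+1))` (the (e) closer's `hUq` at `G`). -/
theorem klEngU₀12G_le_inv_klZs2G : klEngU₀12G G P R cc ≤ 1 / (64 * (|klZs2G G P R| + 1)) :=
  (min_le_right _ _).trans ((min_le_right _ _).trans ((min_le_right _ _).trans ((min_le_right _ _).trans ((min_le_right _ _).trans ((min_le_right _ _).trans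
    ((min_le_right _ _).trans ((min_le_right _ _).trans ((min_le_right _ _).trans (min_le_left _ _)))))))))

/-- `klEngU₀12G ≤ R.cz/(1200·(klZs1G G P R+1))` (#28 U-row at `G`, `klZs1G_mixedRow_of_doors`'s `hU2`). -/
theorem klEngU₀12G_le_cz_klZs1G : klEngU₀12G G P R cc ≤ R.cz / (1200 * (klZs1G G P R + 1)) :=
  (min_le_right _ _).trans ((min_le_right _ _).trans ((min_le_right _ _).trans ((min_le_right _ _).trans ((min_le_right _ _).trans ((min_le_right _ _).trans
    ((min_le_right _ _).trans ((min_le_right _ _).trans ((min_le_right _ _).trans ((min_le_right _ _).trans (min_le_left _ _))))))))))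

/-- `klEngU₀12G ≤ 1/(20·(klZs1G G P R+1))` (#28 U-row at `G`, `hU3`). -/
theorem klEngU₀12G_le_inv_klZs1G : klEngU₀12G G P R cc ≤ 1 / (20 * (klZs1G G P R + 1)) :=
  (min_le_right _ _).trans ((min_le_right _ _).trans ((min_le_right _ _).trans ((min_le_right _ _).trans ((min_le_right _ _).trans ((min_le_right _ _).trans
    ((min_le_right _ _).trans ((min_le_right _ _).trans ((min_le_right _ _).trans ((min_le_right _ _).trans ((min_le_right _ _).trans (min_le_left _ _)))))))))))

/-- `klEngU₀12G ≤ klTowerCoreUC9G G P R (klEngQ9c P R) cc` (D4-at-`G`'s capped core-C threshold; the (b) closer feeds `towerCoreC9G_at_klEngQ9c`'s `hUu` as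
`hUle.trans (klEngU₀12G_le_klTowerCoreUC9G G P R c)`). -/
theorem klEngU₀12G_le_klTowerCoreUC9G : klEngU₀12G G P R cc ≤ klTowerCoreUC9G G P R (klEngQ9c P R) cc :=
  (min_le_right _ _).trans ((min_le_right _ _).trans ((min_le_right _ _).trans ((min_le_right _ _).trans ((min_le_right _ _).trans ((min_le_right _ _).trans
    ((min_le_right _ _).trans ((min_le_right _ _).trans ((min_le_right _ _).trans ((min_le_right _ _).trans ((min_le_right _ _).trans (min_le_right _ _)))))))))))

/-! ### the G-free rows of D3″, lifted through `klEngU₀12G_le_klEngU₀12` (names = D3″'s with `12 ↦ 12G`) -/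

/-- **THE #14 LIFT LINE at `G`**: `klEngU₀12G ≤ klEngU₀10` (the image's `hU10`). -/
theorem klEngU₀12G_le_klEngU₀10 : klEngU₀12G G P R cc ≤ klEngU₀10 P R cc := (klEngU₀12G_le_klEngU₀12 G P R cc).trans (klEngU₀12_le_klEngU₀10 P R cc)

/-- `klEngU₀12G ≤ klCUu2 P R (klEngQ7 P R) (klEngQ9c P R) cc` (class #1; §C row). -/
theorem klEngU₀12G_le_klCUu2 : klEngU₀12G G P R cc ≤ klCUu2 P R (klEngQ7 P R) (klEngQ9c P R) cc :=
  (klEngU₀12G_le_klEngU₀12 G P R cc).trans (klEngU₀12_le_klCUu2 P R cc)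

/-- `klEngU₀12G ≤ klE5uM P R` (class #6 fit input). -/
theorem klEngU₀12G_le_klE5uM : klEngU₀12G G P R cc ≤ klE5uM P R := (klEngU₀12G_le_klEngU₀12 G P R cc).trans (klEngU₀12_le_klE5uM P R cc)

/-- `klEngU₀12G ≤ klE5ShareU2 P R (klEngQ9c P R) cc` (class #3). -/
theorem klEngU₀12G_le_klE5ShareU2 : klEngU₀12G G P R cc ≤ klE5ShareU2 P R (klEngQ9c P R) cc :=
  (klEngU₀12G_le_klEngU₀12 G P R cc).trans (klEngU₀12_le_klE5ShareU2 P R cc)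

/-- `klEngU₀12G ≤ klTowerU P R (klEngQ9c P R) cc` (E1's full tower, v1 deferral). -/
theorem klEngU₀12G_le_klTowerU : klEngU₀12G G P R cc ≤ klTowerU P R (klEngQ9c P R) cc :=
  (klEngU₀12G_le_klEngU₀12 G P R cc).trans (klEngU₀12_le_klTowerU P R cc)

/-- `klEngU₀12G ≤ klEngU₀9` (v1 door). -/
theorem klEngU₀12G_le_klEngU₀9 : klEngU₀12G G P R cc ≤ klEngU₀9 P R cc := (klEngU₀12G_le_klEngU₀12 G P R cc).trans (klEngU₀12_le_klEngU₀9 P R cc)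

/-- `klEngU₀12G ≤ klEngU₀3`. -/
theorem klEngU₀12G_le_klEngU₀3 : klEngU₀12G G P R cc ≤ klEngU₀3 P R cc := (klEngU₀12G_le_klEngU₀12 G P R cc).trans (klEngU₀12_le_klEngU₀3 P R cc)

/-- `klEngU₀12G ≤ klTSU R` (the two-shell witness U-door). -/
theorem klEngU₀12G_le_klTSU : klEngU₀12G G P R cc ≤ klTSU R := (klEngU₀12G_le_klEngU₀12 G P R cc).trans (klEngU₀12_le_klTSU P R cc)

/-- `klEngU₀12G ≤ klLastRespU P R` (#20 (δ′) last-step response door). -/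
theorem klEngU₀12G_le_klLastRespU : klEngU₀12G G P R cc ≤ klLastRespU P R := (klEngU₀12G_le_klEngU₀12 G P R cc).trans (klEngU₀12_le_klLastRespU P R cc)

/-- `klEngU₀12G ≤ klGridU₀ R` (GridLiterals part 1 producer U-row). -/
theorem klEngU₀12G_le_klGridU₀ : klEngU₀12G G P R cc ≤ klGridU₀ R := (klEngU₀12G_le_klEngU₀12 G P R cc).trans (klEngU₀12_le_klGridU₀ P R cc)

/-- `klEngU₀12G ≤ 1/(klReadOscC P R + 1)` (AMENDMENT 21: the mean-free consumers' door). -/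
theorem klEngU₀12G_le_inv_klReadOscC : klEngU₀12G G P R cc ≤ 1 / (klReadOscC P R + 1) :=
  (klEngU₀12G_le_klEngU₀12 G P R cc).trans (klEngU₀12_le_inv_klReadOscC P R cc)

/-- `klEngU₀12G ≤ klTailBookU` (AMENDMENT 22: the (C) n = 0 tail-row booking door). -/
theorem klEngU₀12G_le_klTailBookU : klEngU₀12G G P R cc ≤ klTailBookU := (klEngU₀12G_le_klEngU₀12 G P R cc).trans (klEngU₀12_le_klTailBookU P R cc)

/-- `klEngU₀12G ≤ klTowerUC P R (klEngQ9c P R) cc` (AMENDMENT 23: D1's c-slotted full tower threshold, G-free). -/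
theorem klEngU₀12G_le_klTowerUC : klEngU₀12G G P R cc ≤ klTowerUC P R (klEngQ9c P R) cc :=
  (klEngU₀12G_le_klEngU₀12 G P R cc).trans (klEngU₀12_le_klTowerUC P R cc)

variable {G R}

/-- **`0 < klEngU₀12G G P R cc`** under `G.WF`, `P.WF`, `R.WF2` (a G-keyed image's witness line reads `klEngU₀12G_pos P c hG hP hR`). -/
theorem klEngU₀12G_pos (hG : G.WF) (hP : P.WF) (hR : R.WF2) : 0 < klEngU₀12G G P R cc :=
  lt_min (klEngU₀12_pos P cc hP hR)
    (lt_min (klIsoMomU_pos _ P R _ cc)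
      (lt_min (klE4UF_pos _ P R _ cc)
        (lt_min (klE5FrU_pos_of_wf hG hR)
          (lt_min (klCTu7_pos P R _ _ _ _ cc)
            (lt_min (klE5RowsUG_pos _ P _)
              (lt_min (klZspU5_pos P R _ _ _ cc)
                (lt_min (klGridLitUAtG_pos G P R _ cc)
                  (lt_min (klTwoLegMomU_pos hR.2.2 _ _)
                    (lt_min (by have := abs_nonneg (klZs2G G P R); positivity)
                      (lt_min (by have := klZs1G_nonneg G P R; have := hR.2.2; positivity)
                        (lt_min (by have := klZs1G_nonneg G P R; positivity) (klTowerCoreUC9G_pos G P R _ cc))))))))))))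

end Projections

end Summit.HubbardSuperconductivity.HubbardSuperconductivity.Theorems.EngineV8

end
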